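import Summits.NavierStokesRegularity.NavierStokesRegularity.Theorems.LerayQuarterDissipationFiniteDissipationLiouvilleThresholdBudget
import Summits.NavierStokesRegularity.NavierStokesRegularity.Theorems.LerayQuarterDissipationFiniteDissipationLiouvilleThresholdSecondDerivatives
import Summits.NavierStokesRegularity.NavierStokesRegularity.Theorems.LerayQuarterDissipationRecurrentReductionDScaling
import Literature.Analysis.FluidPDE.TypeIAncientMildRescale
import HarnessLib

/-!
# Crux `FiniteDissipationLiouville` (stmt-NavierStokesRegularity-22144): at the law-free threshold
# `C = 1` a singular member of the stratum has a singular scaling limit whose slice satisfies the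
# EQUALITY CASE `(1 − ‖U‖)·‖DΩ Ω‖ ≡ 0`

Theorems file of route `LerayQuarterDissipation` (lead prover g14; `--supports` the crux; file 4 of
the THRESHOLD-ONE chain). Navier–Stokes regularity is NOT proved by anything here; no summit is.
`𝒟_{C,K}` = Type-I ancient mild fields (KNSS gauge, `‖V(t,x)‖ ≤ C/√(−t)`) with the law
`∫‖∇V(s)‖² ≤ K/√(−s)`; `U = lerayOrbit V`, `Ω = lerayVorticity V = curl U` (similarity variables;
`lerayOrbit V 0 = V(−1,·)`).

* `lerayOrbit_zero`, `slack_le_slack` (the slack `2∫φ_R(C − ‖U‖)‖DΩ Ω‖` of `…ThresholdBudget` is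
  monotone in `R`), `slack_nsRescale_zero` (rescaling shifts similarity time:
  the slack of `nsRescale (e^{−s/2}) V` at `0` is the slack of `V` at `s`);
* `tendsto_slack_zero` — **continuity of the slack along KNSS-convergent sequences** (class-uniform
  bounds on `U, Ω, DΩ` at `t = −1`, pointwise convergence of `U` and `DU` from `Compactness.seqLimit`,
  of `DΩ` from `…ThresholdSecondDerivatives`; dominated convergence on the support of `φ_R`);
* `exists_singular_limit_slack_eq_zero` — **THE EQUALITY CASE IS ATTAINED**: a singular member
  `W ∈ 𝒟_{1,K}` has a sequence of rescalings converging (KNSS) to a SINGULAR `V ∈ 𝒟_{1,K}` with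
  `(1 − ‖V(−1,y)‖) · ‖D(curl V(−1,·))(y)[curl V(−1,·)(y)]‖ = 0` for every `y` (`exists_slack_lt` along
  `R = n+1`, `ε = 1/(n+1)`; monotonicity in `R`; the limit's slack vanishes for every `R`; a
  continuous non-negative integrand with zero integral against `φ_R ≡ 1` on `B̄_R` vanishes).

`…ThresholdOne` turns the equality case into a contradiction.

HONEST FRAMING: a compactness step; constants ineffective.

References: KNSS, arXiv:0709.3599 §4, Lemma 6.1; Leray 1934 §20.
-/

noncomputable section

set_option linter.dupNamespace false

namespace Summit.NavierStokesRegularity.NavierStokesRegularity.Theorems.FiniteDissipationLiouville.ThresholdOne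

open MeasureTheory Set Filter Topology Metric InnerProductSpace Function Real
open scoped RealInnerProductSpace ContDiff
open Literature.Analysis Literature.Analysis.FluidPDE
open Summit.NavierStokesRegularity.NavierStokesRegularity.Theorems
open Summit.NavierStokesRegularity.NavierStokesRegularity.Theorems.GaussianGap
open Summit.NavierStokesRegularity.NavierStokesRegularity.Theorems.FiniteDissipationLiouville

/-! ### Bookkeeping of the slack -/

/-- The similarity slice at `s = 0` is the physical slice at `t = −1`. -/
theorem lerayOrbit_zero (V : ℝ → EuclideanSpace ℝ (Fin 3) → EuclideanSpace ℝ (Fin 3)) :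
    lerayOrbit V 0 = V (-1) := by
  funext y
  simp [lerayOrbit_apply]

/-- **The slack is monotone in the cutoff radius** (`φ_R ≤ φ_{R'}` for `R ≤ R'`, non-negative
integrand). -/
theorem slack_le_slack {C : ℝ} {V : ℝ → EuclideanSpace ℝ (Fin 3) → EuclideanSpace ℝ (Fin 3)}
    (hV : IsTypeIAncientMild C V) {R R' : ℝ} (hR : 0 < R) (hRR' : R ≤ R') (s : ℝ) :
    2 * (∫ y, smoothTransition (2 - ‖y‖ ^ 2 / R ^ 2) *
        ((C - ‖lerayOrbit V s y‖) * ‖fderiv ℝ (lerayVorticity V s) y (lerayVorticity V s y)‖)) ≤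
      2 * (∫ y, smoothTransition (2 - ‖y‖ ^ 2 / R' ^ 2) *
        ((C - ‖lerayOrbit V s y‖) * ‖fderiv ℝ (lerayVorticity V s) y (lerayVorticity V s y)‖)) := by
  have hR' : 0 < R' := lt_of_lt_of_le hR hRR'
  set g : EuclideanSpace ℝ (Fin 3) → ℝ := fun y =>
    (C - ‖lerayOrbit V s y‖) * ‖fderiv ℝ (lerayVorticity V s) y (lerayVorticity V s y)‖ with hg
  have hU1 : ContDiff ℝ 1 (lerayOrbit V s) := mustSqueeze_contDiff_lerayOrbit_slice hV s (n := 1)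
  have hΩ1 : ContDiff ℝ 1 (lerayVorticity V s) := signedBudget_contDiff_lerayVorticity_slice hV s (n := 1)
  have hgc : Continuous g := (continuous_const.sub hU1.continuous.norm).mul
    ((hΩ1.continuous_fderiv one_ne_zero).clm_apply hΩ1.continuous).norm
  have hg0 : ∀ y, 0 ≤ g y := fun y =>
    mul_nonneg (sub_nonneg.2 (norm_lerayOrbit_le_of_typeI hV s y)) (norm_nonneg _)
  have hint : ∀ ρ : ℝ, 0 < ρ → Integrable fun y => smoothTransition (2 - ‖y‖ ^ 2 / ρ ^ 2) * g y :=
    fun ρ hρ => ((contDiff_smoothTransition_cutoff (n := 1) ρ).continuous.mul hgc).integrable_of_hasCompactSupport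
      (hasCompactSupport_smoothTransition_cutoff hρ).mul_right
  refine mul_le_mul_of_nonneg_left (integral_mono (hint R hR) (hint R' hR') fun y => ?_) two_pos.le
  refine mul_le_mul_of_nonneg_right (Real.smoothTransition.monotone ?_) (hg0 y)
  have h1 : ‖y‖ ^ 2 / R' ^ 2 ≤ ‖y‖ ^ 2 / R ^ 2 :=
    div_le_div_of_nonneg_left (sq_nonneg _) (by positivity) (pow_le_pow_left₀ hR.le hRR' 2)
  linarith

/-- **Rescaling shifts similarity time**: the slack of `nsRescale (e^{−s/2}) V` at similarity time `0`
is the slack of `V` at similarity time `s` (`lerayOrbit_nsRescale`). -/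
theorem slack_nsRescale_zero {C : ℝ} (V : ℝ → EuclideanSpace ℝ (Fin 3) → EuclideanSpace ℝ (Fin 3))
    (s R : ℝ) :
    2 * (∫ y, smoothTransition (2 - ‖y‖ ^ 2 / R ^ 2) *
        ((C - ‖lerayOrbit (nsRescale (Real.exp (-s / 2)) V) 0 y‖) *
          ‖fderiv ℝ (lerayVorticity (nsRescale (Real.exp (-s / 2)) V) 0) y
            (lerayVorticity (nsRescale (Real.exp (-s / 2)) V) 0 y)‖)) =
      2 * (∫ y, smoothTransition (2 - ‖y‖ ^ 2 / R ^ 2) *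
        ((C - ‖lerayOrbit V s y‖) * ‖fderiv ℝ (lerayVorticity V s) y (lerayVorticity V s y)‖)) := by
  have hc : 0 < Real.exp (-s / 2) := Real.exp_pos _
  have hs : (0 : ℝ) - 2 * Real.log (Real.exp (-s / 2)) = s := by rw [Real.log_exp]; ring
  have e : lerayOrbit (nsRescale (Real.exp (-s / 2)) V) 0 = lerayOrbit V s := by
    rw [lerayOrbit_nsRescale hc, hs]
  simp only [lerayVorticity_apply, e]

/-! ### Continuity of the slack along KNSS-convergent sequences -/

/-- **The slack at similarity time `0` is continuous along KNSS-convergent sequences of the class.**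
If `v j`, `W` are Type-I ancient mild with a common constant `C`, the `v j` converge to `W` uniformly
on the slab pieces, pointwise on the past together with their spatial gradients, then for every
`R > 0` the slacks `2∫φ_R(C − ‖v_j(−1)‖)‖D(curl v_j(−1))[curl v_j(−1)]‖` converge to that of `W`
(dominated convergence: class-uniform bounds on `U, DU, D²U` at `t = −1`; the vorticity gradients
converge by `tendsto_fderiv_curl_slice`). [cite: KochNadirashviliSereginSverak2009, Prop. 4.1 (arXiv:0709.3599 p. 8)] -/
theorem tendsto_slack_zero {C : ℝ} {v : ℕ → ℝ → EuclideanSpace ℝ (Fin 3) → EuclideanSpace ℝ (Fin 3)}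
    {W : ℝ → EuclideanSpace ℝ (Fin 3) → EuclideanSpace ℝ (Fin 3)}
    (hv : ∀ j, IsTypeIAncientMild C (v j)) (hW : IsTypeIAncientMild C W)
    (hunif : ∀ n : ℕ, TendstoUniformlyOn (fun j z => v j z.1 z.2) (fun z => W z.1 z.2) atTop
      (Icc (-((n : ℝ) + 2)) (-(1 / ((n : ℝ) + 2))) ×ˢ
        closedBall (0 : EuclideanSpace ℝ (Fin 3)) ((n : ℝ) + 2)))
    (hpt : ∀ t < 0, ∀ x, Tendsto (fun j => v j t x) atTop (𝓝 (W t x)))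
    (hgrad : ∀ t < 0, ∀ x, Tendsto (fun j => fderiv ℝ (v j t) x) atTop (𝓝 (fderiv ℝ (W t) x)))
    {R : ℝ} (hR : 0 < R) :
    Tendsto (fun j => 2 * (∫ y, smoothTransition (2 - ‖y‖ ^ 2 / R ^ 2) *
        ((C - ‖v j (-1) y‖) * ‖fderiv ℝ (curl (v j (-1))) y (curl (v j (-1)) y)‖))) atTop
      (𝓝 (2 * (∫ y, smoothTransition (2 - ‖y‖ ^ 2 / R ^ 2) *
        ((C - ‖W (-1) y‖) * ‖fderiv ℝ (curl (W (-1))) y (curl (W (-1)) y)‖)))) := by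
  -- class-uniform bounds at `t = -1`
  obtain ⟨K₁, hK₁0, hK₁⟩ := exists_norm_iteratedFDeriv_slice_le C 1
  obtain ⟨K₂, hK₂0, hK₂⟩ := exists_norm_iteratedFDeriv_slice_le C 2
  set κ : ℝ := ‖curlCLM‖ with hκdef
  have hκ0 : 0 ≤ κ := by rw [hκdef]; exact norm_nonneg curlCLM
  have hC : 0 ≤ C := hW.nonneg
  set φ : EuclideanSpace ℝ (Fin 3) → ℝ := fun y => smoothTransition (2 - ‖y‖ ^ 2 / R ^ 2) with hφdef
  have hφc : Continuous φ := (contDiff_smoothTransition_cutoff (n := 1) R).continuous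
  have hφcs : HasCompactSupport φ := hasCompactSupport_smoothTransition_cutoff hR
  have hφ0 : ∀ y, 0 ≤ φ y := fun y => smoothTransition_cutoff_nonneg R y
  -- generic facts about a class member's slice `-1`
  have hsl : ∀ {f : ℝ → EuclideanSpace ℝ (Fin 3) → EuclideanSpace ℝ (Fin 3)}, IsTypeIAncientMild C f →
      ContDiff ℝ 2 (f (-1)) ∧ (∀ y, ‖f (-1) y‖ ≤ C) ∧ (∀ y, ‖curl (f (-1)) y‖ ≤ κ * K₁) ∧
        (∀ y, ‖fderiv ℝ (curl (f (-1))) y‖ ≤ κ * K₂) := by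
    intro f hf
    have h2 : ContDiff ℝ 2 (f (-1)) := (hf.contDiff_slice (by norm_num)).of_le (by norm_cast)
    refine ⟨h2, fun y => ?_, fun y => ?_, fun y => ?_⟩
    · have := hf.norm_le (by norm_num : (-1 : ℝ) < 0) y
      rwa [neg_neg, Real.sqrt_one, div_one] at this
    · calc ‖curl (f (-1)) y‖ ≤ κ * ‖fderiv ℝ (f (-1)) y‖ := norm_curl_le _ _
        _ ≤ κ * K₁ := by
          rw [← norm_iteratedFDeriv_one]
          exact mul_le_mul_of_nonneg_left (hK₁ hf y) hκ0
    · exact (norm_fderiv_curl_le h2 y).trans (mul_le_mul_of_nonneg_left (hK₂ hf y) hκ0)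
  -- the integrands
  set F : ℕ → EuclideanSpace ℝ (Fin 3) → ℝ := fun j y =>
    φ y * ((C - ‖v j (-1) y‖) * ‖fderiv ℝ (curl (v j (-1))) y (curl (v j (-1)) y)‖) with hFdef
  set Finf : EuclideanSpace ℝ (Fin 3) → ℝ := fun y =>
    φ y * ((C - ‖W (-1) y‖) * ‖fderiv ℝ (curl (W (-1))) y (curl (W (-1)) y)‖) with hFinfdef
  have hcontF : ∀ {f : ℝ → EuclideanSpace ℝ (Fin 3) → EuclideanSpace ℝ (Fin 3)}, IsTypeIAncientMild C f →
      Continuous fun y => φ y * ((C - ‖f (-1) y‖) *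
        ‖fderiv ℝ (curl (f (-1))) y (curl (f (-1)) y)‖) := by
    intro f hf
    have h2 := (hsl hf).1
    have hc1 : ContDiff ℝ 1 (curl (f (-1))) := contDiff_curl (h2.of_le (by norm_cast))
    exact hφc.mul ((continuous_const.sub h2.continuous.norm).mul
      ((hc1.continuous_fderiv one_ne_zero).clm_apply hc1.continuous).norm)
  have key : Tendsto (fun j => ∫ y, F j y) atTop (𝓝 (∫ y, Finf y)) := by
    refine tendsto_integral_of_dominated_convergence (fun y => φ y * (C * (κ * K₂ * (κ * K₁))))
      (fun j => (hcontF (hv j)).aestronglyMeasurable)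
      ((hφc.mul continuous_const).integrable_of_hasCompactSupport hφcs.mul_right)
      (fun j => Eventually.of_forall fun y => ?_) (Eventually.of_forall fun y => ?_)
    · -- domination
      obtain ⟨-, hUb, hΩb, hDΩb⟩ := hsl (hv j)
      rw [hFdef]
      dsimp only
      have h1 : 0 ≤ C - ‖v j (-1) y‖ := sub_nonneg.2 (hUb y)
      have h2 : C - ‖v j (-1) y‖ ≤ C := by linarith [norm_nonneg (v j (-1) y)]
      have h3 : ‖fderiv ℝ (curl (v j (-1))) y (curl (v j (-1)) y)‖ ≤ κ * K₂ * (κ * K₁) :=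
        (ContinuousLinearMap.le_opNorm _ _).trans
          (mul_le_mul (hDΩb y) (hΩb y) (norm_nonneg _) (by positivity))
      rw [Real.norm_eq_abs, abs_of_nonneg (mul_nonneg (hφ0 y) (mul_nonneg h1 (norm_nonneg _)))]
      exact mul_le_mul_of_nonneg_left (mul_le_mul h2 h3 (norm_nonneg _) hC) (hφ0 y)
    · -- pointwise convergence
      have hU := hpt (-1) (by norm_num) y
      have hΩ : Tendsto (fun j => curl (v j (-1)) y) atTop (𝓝 (curl (W (-1)) y)) := by
        simp only [curl_eq_curlCLM]
        exact (curlCLM.continuous.tendsto _).comp (hgrad (-1) (by norm_num) y)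
      have hDΩ := tendsto_fderiv_curl_slice hv hW hunif y
      have happ : Tendsto (fun j => fderiv ℝ (curl (v j (-1))) y (curl (v j (-1)) y)) atTop
          (𝓝 (fderiv ℝ (curl (W (-1))) y (curl (W (-1)) y))) :=
        (isBoundedBilinearMap_apply.continuous.tendsto
          (fderiv ℝ (curl (W (-1))) y, curl (W (-1)) y)).comp (hDΩ.prodMk_nhds hΩ)
      exact tendsto_const_nhds.mul ((tendsto_const_nhds.sub hU.norm).mul happ.norm)
  exact key.const_mul 2

/-! ### The equality case is attained at the threshold -/

/-- **AT `C = 1` THE EQUALITY CASE IS ATTAINED ON A SINGULAR LIMIT.** Let `W ∈ 𝒟_{1,K}` be singular at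
the apex. Then there are rescalings `v j` of `W` (Type-I ancient mild with constant `1`, law `K`,
singular) converging in the sense of `Compactness.seqLimit` to a SINGULAR `V ∈ 𝒟_{1,K}` whose slice
`t = −1` satisfies `(1 − ‖V(−1,y)‖) · ‖D(curl V(−1,·))(y)[curl V(−1,·)(y)]‖ = 0` for every `y`. [cite: KochNadirashviliSereginSverak2009, §4 (arXiv:0709.3599 p. 8)] -/
theorem exists_singular_limit_slack_eq_zero {K : ℝ}
    {W : ℝ → EuclideanSpace ℝ (Fin 3) → EuclideanSpace ℝ (Fin 3)} (hW : IsTypeIAncientMild 1 W)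
    (hlaw : ∀ s : ℝ, s < 0 → ∫⁻ x, ‖fderiv ℝ (W s) x‖ₑ ^ 2 ≤ ENNReal.ofReal (K / Real.sqrt (-s)))
    (hsing : ∀ r > 0, ∀ M : ℝ, ∃ t ∈ Ioo (-(r ^ 2)) (0 : ℝ),
      ∃ x ∈ ball (0 : EuclideanSpace ℝ (Fin 3)) r, M < ‖W t x‖) :
    ∃ V : ℝ → EuclideanSpace ℝ (Fin 3) → EuclideanSpace ℝ (Fin 3), IsTypeIAncientMild 1 V ∧
      (∀ s : ℝ, s < 0 → ∫⁻ x, ‖fderiv ℝ (V s) x‖ₑ ^ 2 ≤ ENNReal.ofReal (K / Real.sqrt (-s))) ∧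
      (∀ r > 0, ∀ M : ℝ, ∃ t ∈ Ioo (-(r ^ 2)) (0 : ℝ),
        ∃ x ∈ ball (0 : EuclideanSpace ℝ (Fin 3)) r, M < ‖V t x‖) ∧
      ∀ y, (1 - ‖V (-1) y‖) * ‖fderiv ℝ (curl (V (-1))) y (curl (V (-1)) y)‖ = 0 := by
  -- ### times with small slack on growing cutoffs
  obtain ⟨L, M, hL0, hM0, hslack⟩ := exists_slack_lt hW le_rfl hlaw
  have hsn : ∀ n : ℕ, ∃ s : ℝ,
      2 * (∫ y, smoothTransition (2 - ‖y‖ ^ 2 / ((n : ℝ) + 1) ^ 2) *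
        ((1 - ‖lerayOrbit W s y‖) * ‖fderiv ℝ (lerayVorticity W s) y (lerayVorticity W s y)‖)) <
        (L * M + 1) / ((n : ℝ) + 1) := by
    intro n
    have hn1 : (1 : ℝ) ≤ (n : ℝ) + 1 := by
      have : (0 : ℝ) ≤ n := n.cast_nonneg
      linarith
    obtain ⟨s, hs⟩ := hslack ((n : ℝ) + 1) hn1 (1 / ((n : ℝ) + 1)) (by positivity)
    refine ⟨s, hs.trans_le (le_of_eq ?_)⟩
    field_simp
  choose sn hsn using hsn
  -- ### the rescaled members
  set v : ℕ → ℝ → EuclideanSpace ℝ (Fin 3) → EuclideanSpace ℝ (Fin 3) := fun n =>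
    nsRescale (Real.exp (-(sn n) / 2)) W with hvdef
  have hμ : ∀ n, 0 < Real.exp (-(sn n) / 2) := fun n => Real.exp_pos _
  have hv : ∀ n, IsTypeIAncientMild 1 (v n) := fun n => hW.nsRescale (hμ n)
  have hvlaw : ∀ n, ∀ s : ℝ, s < 0 →
      ∫⁻ x, ‖fderiv ℝ (v n s) x‖ₑ ^ 2 ≤ ENNReal.ofReal (K / Real.sqrt (-s)) := fun n =>
    RecurrentReductionD.dissipationLaw_nsRescale hlaw (hμ n)
  have hvsing : ∀ n, ∀ r > 0, ∀ M : ℝ, ∃ t ∈ Ioo (-(r ^ 2)) (0 : ℝ),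
      ∃ x ∈ ball (0 : EuclideanSpace ℝ (Fin 3)) r, M < ‖v n t x‖ := fun n =>
    RecurrentReductionD.singularAtOrigin_nsRescale hsing (hμ n)
  -- their slack at similarity time `0`, on the cutoff `R`, for `n + 1 ≥ R`
  have hvslack : ∀ {R : ℝ}, 0 < R → ∀ n : ℕ, R ≤ (n : ℝ) + 1 →
      2 * (∫ y, smoothTransition (2 - ‖y‖ ^ 2 / R ^ 2) *
        ((1 - ‖v n (-1) y‖) * ‖fderiv ℝ (curl (v n (-1))) y (curl (v n (-1)) y)‖)) <
        (L * M + 1) / ((n : ℝ) + 1) := by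
    intro R hR n hn
    have h1 := slack_le_slack (hv n) hR hn 0
    rw [lerayVorticity_apply, lerayOrbit_zero] at h1
    have h2 : 2 * (∫ y, smoothTransition (2 - ‖y‖ ^ 2 / ((n : ℝ) + 1) ^ 2) *
        ((1 - ‖lerayOrbit (v n) 0 y‖) *
          ‖fderiv ℝ (lerayVorticity (v n) 0) y (lerayVorticity (v n) 0 y)‖)) =
        2 * (∫ y, smoothTransition (2 - ‖y‖ ^ 2 / ((n : ℝ) + 1) ^ 2) *
          ((1 - ‖lerayOrbit W (sn n) y‖) *
            ‖fderiv ℝ (lerayVorticity W (sn n)) y (lerayVorticity W (sn n) y)‖)) :=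
      slack_nsRescale_zero (C := 1) W (sn n) ((n : ℝ) + 1)
    rw [lerayVorticity_apply, lerayOrbit_zero] at h2
    have h3 := hsn n
    rw [← h2] at h3
    exact h1.trans_lt h3
  -- ### compactness across members
  obtain ⟨ψ, hψ, V, hV, hunif, hpt, hgrad⟩ := Compactness.seqLimit hv
  have hψt : Tendsto ψ atTop atTop := hψ.tendsto_atTop
  have hVlaw : ∀ s : ℝ, s < 0 →
      ∫⁻ x, ‖fderiv ℝ (V s) x‖ₑ ^ 2 ≤ ENNReal.ofReal (K / Real.sqrt (-s)) :=
    Compactness.law_of_seqLimit (Kk := fun _ => K) (Kinf := K) hψt hvlaw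
      (fun ε hε => Eventually.of_forall fun k => by linarith) hgrad
  have hVsing := Compactness.persistent_singularity_seq (w := fun j => v (ψ j))
    (fun j => hv _) (fun j => hvlaw _) (fun j => hvsing _) hV hunif
  refine ⟨V, hV, hVlaw, hVsing, ?_⟩
  -- ### the limit's slack vanishes on every cutoff
  have hzero : ∀ R : ℝ, 0 < R →
      2 * (∫ y, smoothTransition (2 - ‖y‖ ^ 2 / R ^ 2) *
        ((1 - ‖V (-1) y‖) * ‖fderiv ℝ (curl (V (-1))) y (curl (V (-1)) y)‖)) = 0 := by
    intro R hR
    have hlim := tendsto_slack_zero (fun j => hv (ψ j)) hV hunif hpt hgrad hR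
    -- the slacks along the subsequence tend to `0`
    have hup : Tendsto (fun j => (L * M + 1) / (((ψ j : ℕ) : ℝ) + 1)) atTop (𝓝 0) := by
      have h0 : Tendsto (fun j => 1 / ((((ψ j)) : ℝ) + 1)) atTop (𝓝 0) :=
        tendsto_one_div_add_atTop_nhds_zero_nat.comp hψt
      have e : (fun j => (L * M + 1) / (((ψ j : ℕ) : ℝ) + 1)) =
          fun j => (L * M + 1) * (1 / (((ψ j : ℕ) : ℝ) + 1)) := by
        funext j; rw [div_eq_mul_one_div]
      rw [e, show (0 : ℝ) = (L * M + 1) * 0 by ring]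
      exact h0.const_mul (L * M + 1)
    have hev : ∀ᶠ j in atTop, R ≤ ((ψ j : ℕ) : ℝ) + 1 := by
      have h1 : Tendsto (fun j => ((ψ j : ℕ) : ℝ) + 1) atTop atTop :=
        tendsto_atTop_add_const_right _ 1 (tendsto_natCast_atTop_atTop.comp hψt)
      exact h1.eventually_ge_atTop R
    have hle : ∀ᶠ j in atTop,
        2 * (∫ y, smoothTransition (2 - ‖y‖ ^ 2 / R ^ 2) *
          ((1 - ‖v (ψ j) (-1) y‖) * ‖fderiv ℝ (curl (v (ψ j) (-1))) y (curl (v (ψ j) (-1)) y)‖)) ≤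
          (L * M + 1) / (((ψ j : ℕ) : ℝ) + 1) := by
      filter_upwards [hev] with j hj
      exact (hvslack hR (ψ j) hj).le
    have hge : ∀ j, 0 ≤ 2 * (∫ y, smoothTransition (2 - ‖y‖ ^ 2 / R ^ 2) *
        ((1 - ‖v (ψ j) (-1) y‖) * ‖fderiv ℝ (curl (v (ψ j) (-1))) y (curl (v (ψ j) (-1)) y)‖)) := by
      intro j
      have := slack_nonneg (hv (ψ j)) R 0
      rwa [lerayVorticity_apply, lerayOrbit_zero] at this
    have h1 : (2 * (∫ y, smoothTransition (2 - ‖y‖ ^ 2 / R ^ 2) *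
        ((1 - ‖V (-1) y‖) * ‖fderiv ℝ (curl (V (-1))) y (curl (V (-1)) y)‖))) ≤ 0 :=
      le_of_tendsto_of_tendsto hlim hup hle
    have h2 : 0 ≤ 2 * (∫ y, smoothTransition (2 - ‖y‖ ^ 2 / R ^ 2) *
        ((1 - ‖V (-1) y‖) * ‖fderiv ℝ (curl (V (-1))) y (curl (V (-1)) y)‖)) :=
      ge_of_tendsto' hlim hge
    linarith
  -- ### a continuous non-negative integrand with zero integral vanishes
  intro y
  set g : EuclideanSpace ℝ (Fin 3) → ℝ := fun z =>
    (1 - ‖V (-1) z‖) * ‖fderiv ℝ (curl (V (-1))) z (curl (V (-1)) z)‖ with hgdef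
  have h2V : ContDiff ℝ 2 (V (-1)) := (hV.contDiff_slice (by norm_num)).of_le (by norm_cast)
  have hc1 : ContDiff ℝ 1 (curl (V (-1))) := contDiff_curl (h2V.of_le (by norm_cast))
  have hgc : Continuous g := (continuous_const.sub h2V.continuous.norm).mul
    ((hc1.continuous_fderiv one_ne_zero).clm_apply hc1.continuous).norm
  have hg0 : ∀ z, 0 ≤ g z := fun z => by
    have := hV.norm_le (by norm_num : (-1 : ℝ) < 0) z
    rw [neg_neg, Real.sqrt_one, div_one] at this
    exact mul_nonneg (sub_nonneg.2 this) (norm_nonneg _)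
  set R : ℝ := max 1 ‖y‖ with hRdef
  have hR : 0 < R := lt_of_lt_of_le one_pos (le_max_left _ _)
  set φ : EuclideanSpace ℝ (Fin 3) → ℝ := fun z => smoothTransition (2 - ‖z‖ ^ 2 / R ^ 2) with hφdef
  have hφc : Continuous φ := (contDiff_smoothTransition_cutoff (n := 1) R).continuous
  have hφcs : HasCompactSupport φ := hasCompactSupport_smoothTransition_cutoff hR
  have hφ0 : ∀ z, 0 ≤ φ z := fun z => smoothTransition_cutoff_nonneg R z
  have hint : Integrable fun z => φ z * g z := (hφc.mul hgc).integrable_of_hasCompactSupport hφcs.mul_right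
  have hI0 : ∫ z, φ z * g z = 0 := by
    have h := hzero R hR
    change 2 * (∫ z, φ z * g z) = 0 at h
    linarith
  have hae : (fun z => φ z * g z) =ᵐ[volume] 0 :=
    (integral_eq_zero_iff_of_nonneg (fun z => mul_nonneg (hφ0 z) (hg0 z)) hint).1 hI0
  have hall : (fun z => φ z * g z) = 0 := (hφc.mul hgc).ae_eq_iff_eq volume continuous_const |>.1 hae
  have hy : φ y * g y = 0 := congrFun hall y
  have hφy : φ y = 1 := smoothTransition_cutoff_eq_one hR (le_max_right _ _)
  rw [hφy, one_mul] at hy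
  exact hy

end Summit.NavierStokesRegularity.NavierStokesRegularity.Theorems.FiniteDissipationLiouville.ThresholdOne

end
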